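import Literature.NumberTheory.Transcendental.QuadraticRelationsLogarithmsTransport
import HarnessLib

/-!
# Roy–Waldschmidt 1997: Corollaire 1.4 from Corollaire 1.3 (the printed induction, pp. 759–760, PROVED)

Third step up the printed chain Théorème 0.2 ⇐ Théorème 0.1 ⇐ Corollaire 1.4 ⇐ Corollaire 1.3 ⇐
Théorème 1.1 of D. Roy, M. Waldschmidt, *Approximation diophantienne et indépendance algébrique de
logarithmes*, Ann. Sci. ÉNS (4) 30 (1997) 753–796 (files `…Thm01.lean`, `…Cor14.lean`).

* `RoyWaldschmidt1997.cor_1_4_of_cor_1_3` — **Corollaire 1.4 follows from Corollaire 1.3**, the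
  latter as an explicit hypothesis rendered verbatim (p. 758): "Soient `d₁` un entier positif,
  `K ⊂ ℂ` un corps de degré de transcendance `1` sur `ℚ` et `X` un sous-groupe de type fini de
  `(𝓛_K ∩ K)^{d₁}`. On pose `n = dim_ℂ(ℂX)`, et on suppose `d₁ > n`. On suppose aussi que `ℂ^{d₁}`
  est le seul sous-espace de `ℂ^{d₁}` défini sur `ℚ` qui contienne `X`. Alors, il existe un entier
  positif `d₁'` et une application linéaire surjective `g₁ : ℂ^{d₁} → ℂ^{d₁'}` définie sur `ℚ`
  tels qu'en posant `X' = g₁(X)`, `n' = dim_ℂ(ℂX')` et `ℓ₁' = rang_ℤ(X')` on ait `d₁' > n' > 0`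
  et `d₁/(d₁ - n) ≥ d₁'/(d₁' - n') ≥ ℓ₁'/n'` avec en plus l'inégalité stricte
  `d₁'/(d₁' - n') > ℓ₁'/n'` si `X' ∩ 𝓛^{d₁'} ≠ 0`."
  RENDERING. The two quotient inequalities are stated cross-multiplied (all denominators are
  positive by `d₁ > n`, `d₁' > n' > 0`): `d₁/(d₁-n) ≥ d₁'/(d₁'-n')` ⟺ `d₁ n' ≤ d₁' n`, and
  `d₁'/(d₁'-n') ≥ ℓ₁'/n'` ⟺ `ℓ₁' d₁' ≤ n' (d₁' + ℓ₁')` (strict: `<`); "définie sur `ℚ`" for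
  `g₁` = `g₁` restricts to a `ℚ`-linear map `ℚ^{d₁} → ℚ^{d₁'}`; for subspaces = `ratSpan`.
  DIRECTION OF THE INEQUALITIES. The scan's OCR does not resolve `≥`/`≤`; the direction `≥` is
  the one forced by the two printed uses of the statement: the proof of Corollaire 1.4 (p. 760:
  "Puisque `d ≥ 2n`, on en déduit `ℓ' ≤ 2n'`") and the deduction of Corollaire 1.2 from
  Théorème 1.1 (p. 757: "`d₁/(d₁-2) ≥ ℓ₁/(2-ℓ₀)` … On en tire `μ = d₁ℓ₁ + d₁ℓ₀ ≤ 2(d₁+ℓ₁)`").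
* `royWaldschmidt_quadratic_thm_0_2_of_cor_1_3` — hence Théorème 0.2 from Corollaire 1.3.

Proof of Corollaire 1.4 as printed (pp. 759–760), by strong induction on `d`: `n = 0 ⇒ U = 0`;
`d < 2n ⇒ U = ℂ^d`; if `X` lies in a proper subspace defined over `ℚ`, induct inside it
(`cor_1_4_transport`); otherwise Corollaire 1.3 gives `g`, with `ℓ' ≤ 2n'` (strict if
`X' ∩ 𝓛 ≠ 0`); if `g` is injective take `U = 0`, else induct inside `ker g` for `X* = X ∩ ker g`
and add up: `rang(X/(X ∩ U)) = rang X' + rang(X*/(X* ∩ U)) ≤ 2n' + 2n* - dim U ≤ 2n - dim U`.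

No definitions, no named facts (D-0026).

## References

* [RoyWaldschmidt1997ENS] D. Roy, M. Waldschmidt, Ann. Sci. ÉNS (4) 30 (1997) 753–796:
  Corollaire 1.3 p. 758, Corollaire 1.4 and its proof pp. 759–760, Corollaire 1.2 proof p. 757
  (lit key paper:doi-10-1016-s0012-9593-97-89938-7, PDF pp. 7–9).
-/

noncomputable section

open Complex IntermediateField Module Submodule

namespace Literature.NumberTheory.Transcendental

namespace RoyWaldschmidt1997

open LiePresentation

variable {d : ℕ}

/-! ### Small lemmas -/

/-- `ratSpan ℚ^d = ℂ^d`. [folklore] -/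
theorem ratSpan_univ : ratSpan (Set.univ : Set (Fin d → ℚ)) = ⊤ := by
  classical
  refine eq_top_iff.mpr fun z _ => ?_
  rw [pi_eq_sum_univ z]
  refine Submodule.sum_mem _ fun i _ => Submodule.smul_mem _ _ (subset_span ⟨Pi.single i 1, trivial, ?_⟩)
  funext j
  by_cases h : i = j
  · subst h; simp
  · simp [Ne.symm h, h]

/-- `ratSpan ∅ = 0`. [folklore] -/
theorem ratSpan_empty : ratSpan (∅ : Set (Fin d → ℚ)) = ⊥ := by
  simp [ratSpan]

/-- `ratSpan s` is `ℚ`-rational in the sense of `LiePresentation.IsKRational`. [folklore] -/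
theorem isKRational_ratSpan (s : Set (Fin d → ℚ)) : IsKRational ℚ (ratSpan s) :=
  ⟨s, rfl⟩

/-- A linear map defined over `ℚ` in coordinates: `(g x)ᵢ = ∑ⱼ g₀(eⱼ)ᵢ xⱼ`. [folklore] -/
theorem apply_eq_sum_of_rat {d' : ℕ} (g : (Fin d → ℂ) →ₗ[ℂ] (Fin d' → ℂ))
    (g₀ : (Fin d → ℚ) →ₗ[ℚ] (Fin d' → ℚ))
    (hg : ∀ v : Fin d → ℚ, g (fun j => ((v j : ℚ) : ℂ)) = fun i => ((g₀ v i : ℚ) : ℂ))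
    (x : Fin d → ℂ) (i : Fin d') : g x i = ∑ j, ((g₀ (Pi.single j 1) i : ℚ) : ℂ) * x j := by
  classical
  have hx : x = ∑ j, x j • (fun k => (((Pi.single j (1 : ℚ) : Fin d → ℚ) k : ℚ) : ℂ)) := by
    funext k
    simp only [Finset.sum_apply, Pi.smul_apply, smul_eq_mul]
    rw [Finset.sum_eq_single k]
    · simp
    · intro j _ hjk; simp [Ne.symm hjk]
    · simp
  conv_lhs => rw [hx, map_sum]
  simp only [Finset.sum_apply, map_smul, Pi.smul_apply, smul_eq_mul, hg]
  exact Finset.sum_congr rfl fun j _ => mul_comm _ _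

/-- A linear map defined over `ℚ` maps `𝓛^d` into `𝓛^{d'}`. [folklore] -/
theorem isAlgebraic_cexp_apply_of_rat {d' : ℕ} (g : (Fin d → ℂ) →ₗ[ℂ] (Fin d' → ℂ))
    (g₀ : (Fin d → ℚ) →ₗ[ℚ] (Fin d' → ℚ))
    (hg : ∀ v : Fin d → ℚ, g (fun j => ((v j : ℚ) : ℂ)) = fun i => ((g₀ v i : ℚ) : ℂ))
    {x : Fin d → ℂ} (hx : ∀ j, IsAlgebraic ℚ (cexp (x j))) (i : Fin d') :
    IsAlgebraic ℚ (cexp (g x i)) := by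
  rw [apply_eq_sum_of_rat g g₀ hg]
  exact isAlgebraic_cexp_sum_rat_mul hx _

/-- The arithmetic of p. 760: `d ≥ 2n > 0`, `d n' ≤ d' n` and `ℓ' d' ≤ n'(d' + ℓ')` give
`ℓ' ≤ 2n'`; with `<` in the last hypothesis, `ℓ' < 2n'`. [cite: RoyWaldschmidt1997ENS, proof of Corollaire 1.4 p. 760 ("Puisque d ≥ 2n, on en déduit ℓ' ≤ 2n'")] -/
theorem le_two_mul_of_ineqs {n n' d' l' : ℕ} {d : ℕ} (hn : 0 < n) (hd : 2 * n ≤ d) (hd' : 0 < d')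
    (h1 : d * n' ≤ d' * n) (h2 : l' * d' ≤ n' * (d' + l')) :
    l' ≤ 2 * n' ∧ (l' * d' < n' * (d' + l') → l' < 2 * n') := by
  have h2n' : 2 * n' ≤ d' := by
    have : 2 * n * n' ≤ d' * n := le_trans (by nlinarith) h1
    exact Nat.le_of_mul_le_mul_right (by nlinarith) hn
  constructor
  · have : l' * d' ≤ 2 * n' * d' := by nlinarith
    exact Nat.le_of_mul_le_mul_right this hd'
  · intro h3
    have : l' * d' < 2 * n' * d' := by nlinarith
    exact Nat.lt_of_mul_lt_mul_right this

/-- Rank–nullity inside a subspace: `dim g(W) + dim (W ∩ ker g) = dim W`. [folklore] -/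
theorem finrank_map_add_finrank_inf_ker_complex {d' : ℕ} (W : Submodule ℂ (Fin d → ℂ))
    (g : (Fin d → ℂ) →ₗ[ℂ] (Fin d' → ℂ)) :
    Module.finrank ℂ ↥(W.map g) + Module.finrank ℂ ↥(W ⊓ LinearMap.ker g) = Module.finrank ℂ W := by
  have h := LinearMap.finrank_range_add_finrank_ker (g.comp W.subtype)
  rw [LinearMap.range_comp, Submodule.range_subtype, LinearMap.ker_comp] at h
  rw [← h]
  congr 1
  have e1 : ((LinearMap.ker g).comap W.subtype).map W.subtype = W ⊓ LinearMap.ker g :=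
    Submodule.map_comap_subtype _ _
  exact (LinearEquiv.finrank_eq ((Submodule.equivMapOfInjective _ W.injective_subtype _).trans
    (LinearEquiv.ofEq _ _ e1))).symm

/-! ### Corollaire 1.4 from Corollaire 1.3 -/

/-- **Roy–Waldschmidt 1997: Corollaire 1.4 follows from Corollaire 1.3 (the printed induction on
`d`, pp. 759–760, PROVED).**  Hypothesis `h13` is Corollaire 1.3 verbatim (p. 758; quotient
inequalities cross-multiplied, see the module docstring); conclusion: Corollaire 1.4 (p. 759) in
the exact form of the hypothesis `h14` of `thm_0_1_of_cor_1_4`.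
[cite: RoyWaldschmidt1997ENS, Corollaire 1.3 p. 758, Corollaire 1.4 pp. 759–760] -/
theorem cor_1_4_of_cor_1_3
    (h13 : ∀ (K : IntermediateField ℚ ℂ), Algebra.trdeg ℚ K = 1 →
      ∀ (d : ℕ), 0 < d → ∀ (X : Submodule ℤ (Fin d → ℂ)), X.FG →
        (∀ x ∈ X, ∀ i, x i ∈ K ∧ cexp (x i) ∈ K) →
        Module.finrank ℂ (span ℂ (X : Set (Fin d → ℂ))) < d →
        (∀ s : Set (Fin d → ℚ), X ≤ (ratSpan s).restrictScalars ℤ → ratSpan s = ⊤) →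
        ∃ (d' : ℕ) (g : (Fin d → ℂ) →ₗ[ℂ] (Fin d' → ℂ)) (g₀ : (Fin d → ℚ) →ₗ[ℚ] (Fin d' → ℚ)),
          0 < d' ∧ Function.Surjective g ∧
          (∀ v : Fin d → ℚ, g (fun j => ((v j : ℚ) : ℂ)) = fun i => ((g₀ v i : ℚ) : ℂ)) ∧
          Module.finrank ℂ (span ℂ (X.map (g.restrictScalars ℤ) : Set (Fin d' → ℂ))) < d' ∧
          0 < Module.finrank ℂ (span ℂ (X.map (g.restrictScalars ℤ) : Set (Fin d' → ℂ))) ∧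
          d * Module.finrank ℂ (span ℂ (X.map (g.restrictScalars ℤ) : Set (Fin d' → ℂ))) ≤
            d' * Module.finrank ℂ (span ℂ (X : Set (Fin d → ℂ))) ∧
          Module.finrank ℤ ↥(X.map (g.restrictScalars ℤ)) * d' ≤
            Module.finrank ℂ (span ℂ (X.map (g.restrictScalars ℤ) : Set (Fin d' → ℂ))) *
              (d' + Module.finrank ℤ ↥(X.map (g.restrictScalars ℤ))) ∧
          ((∃ x ∈ X.map (g.restrictScalars ℤ), x ≠ 0 ∧ ∀ i, IsAlgebraic ℚ (cexp (x i))) →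
            Module.finrank ℤ ↥(X.map (g.restrictScalars ℤ)) * d' <
              Module.finrank ℂ (span ℂ (X.map (g.restrictScalars ℤ) : Set (Fin d' → ℂ))) *
                (d' + Module.finrank ℤ ↥(X.map (g.restrictScalars ℤ)))))
    (K : IntermediateField ℚ ℂ) (hK : Algebra.trdeg ℚ K = 1) (d : ℕ)
    (X : Submodule ℤ (Fin d → ℂ)) (hX : X.FG) (hXK : ∀ x ∈ X, ∀ i, x i ∈ K ∧ cexp (x i) ∈ K) :
    ∃ U : Submodule ℂ (Fin d → ℂ), (∃ s : Set (Fin d → ℚ), U = ratSpan s) ∧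
      Module.finrank ℤ (↥X ⧸ (U.restrictScalars ℤ).comap X.subtype) + Module.finrank ℂ U ≤
        2 * Module.finrank ℂ (span ℂ (X : Set (Fin d → ℂ))) ∧
      ((∃ x ∈ X, x ≠ 0 ∧ ∀ i, IsAlgebraic ℚ (cexp (x i))) →
        Module.finrank ℤ (↥X ⧸ (U.restrictScalars ℤ).comap X.subtype) + Module.finrank ℂ U <
          2 * Module.finrank ℂ (span ℂ (X : Set (Fin d → ℂ)))) := by
  classical
  induction d using Nat.strong_induction_on with
  | _ d ih =>
  haveI : Module.Finite ℤ X := Module.Finite.iff_fg.mpr hX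
  set n := Module.finrank ℂ (span ℂ (X : Set (Fin d → ℂ))) with hn
  have hXspan : ∀ x ∈ X, x ∈ span ℂ (X : Set (Fin d → ℂ)) := fun x hx => subset_span hx
  have hbook := finrank_quotient_add_finrank_inf X hX
  -- `n = 0`: `X = 0`, take `U = 0`
  by_cases hn0 : n = 0
  · have hX0 : ∀ x ∈ X, x = 0 := fun x hx => by
      have : span ℂ (X : Set (Fin d → ℂ)) = ⊥ := Submodule.finrank_eq_zero.mp (hn ▸ hn0)
      simpa [this] using hXspan x hx
    refine ⟨⊥, ⟨∅, ratSpan_empty.symm⟩, ?_, ?_⟩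
    · have hXbot : X = ⊥ := (Submodule.eq_bot_iff X).mpr hX0
      have h1 := hbook ⊥
      have h2 : Module.finrank ℤ ↥X = 0 := by rw [hXbot, finrank_bot]
      rw [finrank_bot]
      omega
    · rintro ⟨x, hx, hx0, -⟩
      exact absurd (hX0 x hx) hx0
  have hnpos : 0 < n := Nat.pos_of_ne_zero hn0
  -- `d < 2n`: take `U = ℂ^d`
  by_cases hd2 : d < 2 * n
  · refine ⟨⊤, ⟨Set.univ, ratSpan_univ.symm⟩, ?_⟩
    have h1 := hbook ⊤
    have h2 : Module.finrank ℤ ↥(X ⊓ (⊤ : Submodule ℂ (Fin d → ℂ)).restrictScalars ℤ) =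
        Module.finrank ℤ ↥X := by
      rw [Submodule.restrictScalars_top, inf_top_eq]
    have h3 : Module.finrank ℂ (⊤ : Submodule ℂ (Fin d → ℂ)) = d := by
      rw [finrank_top, Module.finrank_fin_fun]
    rw [h3]
    constructor
    · omega
    · intro _; omega
  have hd2' : 2 * n ≤ d := not_lt.mp hd2
  -- `X` inside a proper subspace defined over `ℚ`: induct inside it
  by_cases hV : ∃ s : Set (Fin d → ℚ), X ≤ (ratSpan s).restrictScalars ℤ ∧ ratSpan s ≠ ⊤
  · obtain ⟨s, hXs, hstop⟩ := hV
    have hm : Module.finrank ℂ (ratSpan s) < d := by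
      refine lt_of_le_of_ne ?_ fun h => hstop (Submodule.eq_top_of_finrank_eq ?_)
      · exact (Submodule.finrank_le _).trans_eq (Module.finrank_fin_fun ℂ)
      · rw [h, Module.finrank_fin_fun]
    obtain ⟨U, hUrat, -, hle, hlt⟩ :=
      cor_1_4_transport K (fun Y hY hYK => ih _ hm Y hY hYK) (isKRational_ratSpan s) rfl X hX hXs hXK
    exact ⟨U, hUrat, hle, hlt⟩
  push Not at hV
  -- Corollaire 1.3
  have hdpos : 0 < d := by omega
  have hnd : n < d := by omega
  obtain ⟨d', g, g₀, hd', hgs, hgrat, -, -, h1, h2, h3⟩ := h13 K hK d hdpos X hX hXK hnd hV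
  obtain ⟨hl'le, hl'lt⟩ := le_two_mul_of_ineqs hnpos hd2' hd' h1 h2
  -- `n' + dim(ℂX ∩ ker g) = n` and `ℓ' + rang(X ∩ ker g) = rang X`
  have hspan' : span ℂ (X.map (g.restrictScalars ℤ) : Set (Fin d' → ℂ)) =
      (span ℂ (X : Set (Fin d → ℂ))).map g := by
    rw [Submodule.map_span]; rfl
  have hnn : Module.finrank ℂ (span ℂ (X.map (g.restrictScalars ℤ) : Set (Fin d' → ℂ))) +
      Module.finrank ℂ ↥(span ℂ (X : Set (Fin d → ℂ)) ⊓ LinearMap.ker g) = n := by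
    rw [hspan']; exact finrank_map_add_finrank_inf_ker_complex _ g
  have hll := finrank_map_add_finrank_inf_ker X hX g
  -- images of `𝓛`-points are `𝓛`-points
  have hgalg : ∀ x : Fin d → ℂ, (∀ j, IsAlgebraic ℚ (cexp (x j))) →
      ∀ i, IsAlgebraic ℚ (cexp (g x i)) := fun x hx => isAlgebraic_cexp_apply_of_rat g g₀ hgrat hx
  by_cases hker : LinearMap.ker g = ⊥
  · -- `g` injective: `U = 0`
    refine ⟨⊥, ⟨∅, ratSpan_empty.symm⟩, ?_⟩
    have hb1 := hbook ⊥
    have hb2 : Module.finrank ℤ ↥(X ⊓ (⊥ : Submodule ℂ (Fin d → ℂ)).restrictScalars ℤ) = 0 := by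
      rw [Submodule.restrictScalars_bot, inf_bot_eq, finrank_bot]
    have hb3 : Module.finrank ℤ ↥(X ⊓ (LinearMap.ker g).restrictScalars ℤ) = 0 := by
      rw [hker, Submodule.restrictScalars_bot, inf_bot_eq, finrank_bot]
    have hb4 : Module.finrank ℂ ↥(span ℂ (X : Set (Fin d → ℂ)) ⊓ LinearMap.ker g) = 0 := by
      rw [hker, inf_bot_eq, finrank_bot]
    rw [finrank_bot]
    constructor
    · omega
    · rintro ⟨x, hx, hx0, hxalg⟩
      have hx' : ∃ x' ∈ X.map (g.restrictScalars ℤ), x' ≠ 0 ∧ ∀ i, IsAlgebraic ℚ (cexp (x' i)) := by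
        refine ⟨g x, ⟨x, hx, rfl⟩, fun h0 => hx0 ?_, hgalg x hxalg⟩
        exact (LinearMap.ker_eq_bot.mp hker) (by rw [h0, map_zero])
      have := hl'lt (h3 hx')
      omega
  · -- `g` not injective: induct inside `ker g` for `X* = X ∩ ker g`
    have hgrat' : ∀ v : Fin d → ℚ, g (ofK ℚ v) = ofK ℚ (g₀ v) := fun v => hgrat v
    have hVrat : IsKRational ℚ (LinearMap.ker g) := by
      have : IsKRational ℚ (⊥ : Submodule ℂ (Fin d' → ℂ)) := ⟨∅, by simp⟩
      simpa using this.comap_of_ofK g g₀ hgrat'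
    have hdstar : Module.finrank ℂ (LinearMap.ker g) < d := by
      refine lt_of_le_of_ne ?_ fun h => ?_
      · exact (Submodule.finrank_le _).trans_eq (Module.finrank_fin_fun ℂ)
      · have htop : LinearMap.ker g = ⊤ :=
          Submodule.eq_top_of_finrank_eq (by rw [h, Module.finrank_fin_fun])
        have hg0 : g = 0 := LinearMap.ker_eq_top.mp htop
        have : Module.finrank ℂ (Fin d' → ℂ) = 0 := by
          rw [← finrank_top, ← LinearMap.range_eq_top.mpr hgs, hg0, LinearMap.range_zero, finrank_bot]
        rw [Module.finrank_fin_fun] at this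
        omega
    let Xs : Submodule ℤ (Fin d → ℂ) := X ⊓ (LinearMap.ker g).restrictScalars ℤ
    have hXsfg : Xs.FG := Submodule.FG.of_le_of_isNoetherian (inf_le_left : Xs ≤ X)
    have hXsK : ∀ x ∈ Xs, ∀ i, x i ∈ K ∧ cexp (x i) ∈ K := fun x hx => hXK x hx.1
    obtain ⟨U, hUrat, hUV, hle, hlt⟩ :=
      cor_1_4_transport K (fun Y hY hYK => ih _ hdstar Y hY hYK) hVrat rfl Xs hXsfg
        (inf_le_right : Xs ≤ _) hXsK
    refine ⟨U, hUrat, ?_⟩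
    -- bookkeeping
    have hb1 := hbook U
    have hb2 := finrank_quotient_add_finrank_inf Xs hXsfg U
    have hb3 : Xs ⊓ U.restrictScalars ℤ = X ⊓ U.restrictScalars ℤ := by
      refine le_antisymm (inf_le_inf_right _ inf_le_left) (le_inf (le_inf inf_le_left ?_) inf_le_right)
      exact inf_le_right.trans fun y hy => hUV hy
    rw [hb3] at hb2
    have hk : Module.finrank ℤ ↥(X ⊓ (LinearMap.ker g).restrictScalars ℤ) = Module.finrank ℤ ↥Xs := rfl
    have hns : Module.finrank ℂ (span ℂ (Xs : Set (Fin d → ℂ))) ≤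
        Module.finrank ℂ ↥(span ℂ (X : Set (Fin d → ℂ)) ⊓ LinearMap.ker g) := by
      refine Submodule.finrank_mono (le_inf (span_mono fun x hx => hx.1) (span_le.mpr fun x hx => hx.2))
    constructor
    · omega
    · rintro ⟨x, hx, hx0, hxalg⟩
      by_cases hgx : g x = 0
      · have hxs : ∃ y ∈ Xs, y ≠ 0 ∧ ∀ i, IsAlgebraic ℚ (cexp (y i)) :=
          ⟨x, ⟨hx, LinearMap.mem_ker.mpr hgx⟩, hx0, hxalg⟩
        have := hlt hxs
        omega
      · have hx' : ∃ x' ∈ X.map (g.restrictScalars ℤ), x' ≠ 0 ∧ ∀ i, IsAlgebraic ℚ (cexp (x' i)) :=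
          ⟨g x, ⟨x, hx, rfl⟩, hgx, hgalg x hxalg⟩
        have := hl'lt (h3 hx')
        omega

end RoyWaldschmidt1997

open RoyWaldschmidt1997 in
/-- **Roy–Waldschmidt 1997: Théorème 0.2 from Corollaire 1.3** (composition of the three printed
deductions Théorème 0.2 ⇐ Théorème 0.1 (§7), Théorème 0.1 ⇐ Corollaire 1.4 (p. 760) and
Corollaire 1.4 ⇐ Corollaire 1.3 (pp. 759–760), all PROVED; Corollaire 1.3 ⇐ Théorème 1.1
(pp. 758–759) and Théorème 1.1 itself (§§2–6) remain).
[cite: RoyWaldschmidt1997ENS, Corollaire 1.3 p. 758, Théorème 0.2 p. 755] -/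
theorem royWaldschmidt_quadratic_thm_0_2_of_cor_1_3
    (h13 : ∀ (K : IntermediateField ℚ ℂ), Algebra.trdeg ℚ K = 1 →
      ∀ (d : ℕ), 0 < d → ∀ (X : Submodule ℤ (Fin d → ℂ)), X.FG →
        (∀ x ∈ X, ∀ i, x i ∈ K ∧ cexp (x i) ∈ K) →
        Module.finrank ℂ (span ℂ (X : Set (Fin d → ℂ))) < d →
        (∀ s : Set (Fin d → ℚ), X ≤ (ratSpan s).restrictScalars ℤ → ratSpan s = ⊤) →
        ∃ (d' : ℕ) (g : (Fin d → ℂ) →ₗ[ℂ] (Fin d' → ℂ)) (g₀ : (Fin d → ℚ) →ₗ[ℚ] (Fin d' → ℚ)),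
          0 < d' ∧ Function.Surjective g ∧
          (∀ v : Fin d → ℚ, g (fun j => ((v j : ℚ) : ℂ)) = fun i => ((g₀ v i : ℚ) : ℂ)) ∧
          Module.finrank ℂ (span ℂ (X.map (g.restrictScalars ℤ) : Set (Fin d' → ℂ))) < d' ∧
          0 < Module.finrank ℂ (span ℂ (X.map (g.restrictScalars ℤ) : Set (Fin d' → ℂ))) ∧
          d * Module.finrank ℂ (span ℂ (X.map (g.restrictScalars ℤ) : Set (Fin d' → ℂ))) ≤
            d' * Module.finrank ℂ (span ℂ (X : Set (Fin d → ℂ))) ∧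
          Module.finrank ℤ ↥(X.map (g.restrictScalars ℤ)) * d' ≤
            Module.finrank ℂ (span ℂ (X.map (g.restrictScalars ℤ) : Set (Fin d' → ℂ))) *
              (d' + Module.finrank ℤ ↥(X.map (g.restrictScalars ℤ))) ∧
          ((∃ x ∈ X.map (g.restrictScalars ℤ), x ≠ 0 ∧ ∀ i, IsAlgebraic ℚ (cexp (x i))) →
            Module.finrank ℤ ↥(X.map (g.restrictScalars ℤ)) * d' <
              Module.finrank ℂ (span ℂ (X.map (g.restrictScalars ℤ) : Set (Fin d' → ℂ))) *
                (d' + Module.finrank ℤ ↥(X.map (g.restrictScalars ℤ))))) :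
    royWaldschmidt_quadratic_thm_0_2 :=
  royWaldschmidt_quadratic_thm_0_2_of_cor_1_4 fun K hK d X hX hXK =>
    cor_1_4_of_cor_1_3 h13 K hK d X hX hXK

end Literature.NumberTheory.Transcendental
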